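import Literature.RepresentationTheory.Ichino2022.FockKTypeCorrespondence

/-!
# Ichino (2022) Lemma 7.10 HOLDS in the explicit polynomial Fock model `ℂ[z₁, z₂, w]` of `(U(1), U(2,1))`

`Literature.RepresentationTheory.Ichino2022.FockKTypeCorrespondence` types [Ich22] = A. Ichino, Adv. Math. 398 (2022)
108188, §7.5 Lemma 7.10 as a PREDICATE `FockHarmonics.Lemma_7_10` on a dictionary.  For the signature
`(p,q;r,s) = (1,0;2,1)` — the compact `U(1) = U(W)` of a one-dimensional skew-Hermitian `W` against `U(2,1) = U(V)` —
the Fock model is an EXPLICIT object: the polynomial ring `ℂ[z₁, z₂, w]` ([Ad07] J. Adams, *The theta correspondence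
over ℝ* (2007) §4: the Fock model `ℂ[z]` on which `𝔨` acts by degree-preserving operators and `𝔭′⁻` by second-order
constant-coefficient differential operators; for this pair: `z_a` spans the `V⁺ ⊗ W` block, `w` the conjugated
`V⁻ ⊗ W` block).  Relative to the vacuum, the compact groups act through WEIGHTS of monomials: `U(W) = U(1)` by
`z_a ↦ +1, w ↦ −1` (`uW`), the torus of `U(2)_V ⊂ K′` by the row weights `z_a ↦ e_a` (`rowW a`), `U(1)_V ⊂ K′` by
minus the `w`-degree (`wDeg`); the raising operator of `𝔲(2)_V` is `E₊ = z₁ ∂_{z₂}` and the two `𝔭′⁻`-operators are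
`Δ_a = ∂_{z_a} ∂_w` (up to non-zero scalars).  This file PROVES Lemma 7.10 for this model:

* `IsHarmonic` (= [Ad07] Def 6.1: killed by `𝔭′⁻`), `isHarmonic_iff_support` (`ℋ = ℂ[z₁,z₂] + w ℂ[w]`);
* `IsHWVector f k n₁ n₂ e` — joint harmonic highest-weight vector with `U(W)`-weight `k`, row weights `(n₁,n₂)`,
  `w`-degree `e` (weights as Mathlib's `MvPolynomial.IsWeightedHomogeneous`), killed by `E₊`, non-zero;
* `isHWVector_iff` — these are EXACTLY `c·z₁^a` (`a ≥ 0`) and `c·w^d` (`d ≥ 1`);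
* (in the companion `…Ichino2022.ExplicitLineLemma`) `explicitLine S hr : FockHarmonics S` — the dictionary of the
  explicit model (the §4.1 exponents `m₀, n₀` entering as the printed vacuum SHIFTS) and
  **`lemma_7_10_explicitLine`** — `(explicitLine S hr).Lemma_7_10`.

So for this signature the cited lemma is a THEOREM of the explicit model; what a construction of the archimedean Weil
representation must supply is only the identification of its `K × K′`-finite vectors with this model (Bargmann
transform).  Companion package file (pub-hodgecm): `HodgeCM/Model/Binders/IchinoExplicitLine.lean` (same mathematics
over the package's `weightOp` API).

## References
* A. Ichino, Adv. Math. 398 (2022) 108188, §4.1, §7.5 Lemma 7.10. [Ichino2022ThetaReal]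
* J. Adams, *The theta correspondence over ℝ*, in: Harmonic Analysis, Group Representations, Automorphic Forms and
  Invariant Theory, World Sci. (2007), §4, Def 6.1, Thm 6.3. [Adams2007Theta]
-/

namespace Literature.RepresentationTheory.Ichino2022

namespace ExplicitLine

open MvPolynomial Finsupp FockHarmonics HarmonicParam

/-! ## §0 The model `ℂ[z₁, z₂, w]` and its weights -/

/-- Variables: `inl a` is `z_a` (`a ∈ Fin 2`, the `V⁺` index), `inr ()` is `w`. [cite: Adams2007Theta, §4] -/
abbrev Var : Type := Fin 2 ⊕ Unit

/-- The explicit Fock model `ℂ[z₁, z₂, w]` of `(U(1), U(2,1))`. [cite: Adams2007Theta, §4] -/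
abbrev Model : Type := MvPolynomial Var ℂ

/-- `U(W) = U(1)` weight: `z_a ↦ +1`, `w ↦ −1`. [cite: Ichino2022ThetaReal, §7.5 Lemma 7.10] -/
def uW : Var → ℤ
  | Sum.inl _ => 1
  | Sum.inr _ => -1

/-- `U(2)_V`-torus (row) weights: `z_a ↦ e_a`, `w ↦ 0`. [cite: Ichino2022ThetaReal, §7.5 Lemma 7.10] -/
def rowW (a : Fin 2) : Var → ℤ
  | Sum.inl a' => if a' = a then 1 else 0
  | Sum.inr _ => 0

/-- the `w`-degree (the `U(1)_V`-weight is minus it, relative to the vacuum). [cite: Ichino2022ThetaReal, §7.5 Lemma 7.10] -/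
def wDeg : Var → ℤ
  | Sum.inl _ => 0
  | Sum.inr _ => 1

/-- Weighted degree for `uW`. [folklore] -/
theorem weight_uW (d : Var →₀ ℕ) :
    weight uW d = (d (Sum.inl 0) : ℤ) + d (Sum.inl 1) - d (Sum.inr ()) := by
  rw [weight_apply, Finsupp.sum_fintype _ _ (by simp)]
  simp only [uW, Fintype.sum_sum_type, Fin.sum_univ_two, Fintype.sum_unique]
  ring

/-- Weighted degree for `rowW a`. [folklore] -/
theorem weight_rowW (a : Fin 2) (d : Var →₀ ℕ) : weight (rowW a) d = (d (Sum.inl a) : ℤ) := by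
  rw [weight_apply, Finsupp.sum_fintype _ _ (by simp)]
  simp only [rowW, Fintype.sum_sum_type, Fin.sum_univ_two, Fintype.sum_unique]
  fin_cases a <;> simp

/-- Weighted degree for `wDeg`. [folklore] -/
theorem weight_wDeg (d : Var →₀ ℕ) : weight wDeg d = (d (Sum.inr ()) : ℤ) := by
  rw [weight_apply, Finsupp.sum_fintype _ _ (by simp)]
  simp only [wDeg, Fintype.sum_sum_type, Fin.sum_univ_two, Fintype.sum_unique]
  ring

/-- Extensionality for exponent vectors on the three variables. [folklore] -/
theorem var_ext {m m' : Var →₀ ℕ} (h0 : m (Sum.inl 0) = m' (Sum.inl 0))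
    (h1 : m (Sum.inl 1) = m' (Sum.inl 1)) (h2 : m (Sum.inr ()) = m' (Sum.inr ())) : m = m' := by
  ext v
  rcases v with ⟨i, hi⟩ | u
  · interval_cases i
    · exact h0
    · exact h1
  · obtain ⟨⟩ := u
    exact h2

/-- The exponent vector `(n₁, n₂, e)` of `z₁^{n₁} z₂^{n₂} w^{e}`. [folklore] -/
noncomputable def expo (n₁ n₂ e : ℕ) : Var →₀ ℕ :=
  single (Sum.inl 0) n₁ + single (Sum.inl 1) n₂ + single (Sum.inr ()) e

/-- [folklore] -/
@[simp] theorem expo_inl0 (n₁ n₂ e : ℕ) : expo n₁ n₂ e (Sum.inl 0) = n₁ := by simp [expo]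
/-- [folklore] -/
@[simp] theorem expo_inl1 (n₁ n₂ e : ℕ) : expo n₁ n₂ e (Sum.inl 1) = n₂ := by simp [expo]
/-- [folklore] -/
@[simp] theorem expo_inr (n₁ n₂ e : ℕ) : expo n₁ n₂ e (Sum.inr ()) = e := by simp [expo]

/-- `z₁^a` as a monomial. [folklore] -/
theorem X_inl0_pow_eq (a : ℕ) : (X (Sum.inl 0) : Model) ^ a = monomial (expo a 0 0) 1 := by
  rw [X_pow_eq_monomial, expo]; simp

/-- `w^d` as a monomial. [folklore] -/
theorem X_inr_pow_eq (d : ℕ) : (X (Sum.inr ()) : Model) ^ d = monomial (expo 0 0 d) 1 := by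
  rw [X_pow_eq_monomial, expo]; simp

/-! ## §1 The `𝔭′⁻`-operators `Δ_a = ∂_{z_a} ∂_w`, the raising operator `E₊ = z₁ ∂_{z₂}`, the harmonics -/

/-- **`Δ_a = ∂_{z_a} ∂_w`** (`a ∈ Fin 2`): the two `𝔭′⁻`-operators of `𝔲(2,1)_ℂ` on the model, up to non-zero scalars.
[cite: Adams2007Theta, §4] -/
noncomputable def Delta (a : Fin 2) : Model →ₗ[ℂ] Model where
  toFun f := pderiv (Sum.inl a) (pderiv (Sum.inr ()) f)
  map_add' f g := by simp only [map_add]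
  map_smul' r f := by simp only [Derivation.map_smul, RingHom.id_apply]

/-- [cite: Adams2007Theta, §4] -/
theorem Delta_apply (a : Fin 2) (f : Model) : Delta a f = pderiv (Sum.inl a) (pderiv (Sum.inr ()) f) := rfl

/-- **`E₊ = z₁ ∂_{z₂}`**, the raising operator of `𝔲(2)_V`. [cite: Adams2007Theta, §4] -/
noncomputable def Eplus : Model →ₗ[ℂ] Model where
  toFun f := X (Sum.inl 0) * pderiv (Sum.inl 1) f
  map_add' f g := by simp only [map_add, mul_add]
  map_smul' r f := by simp only [Derivation.map_smul, mul_smul_comm, RingHom.id_apply]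

/-- [cite: Adams2007Theta, §4] -/
theorem Eplus_apply (f : Model) : Eplus f = X (Sum.inl 0) * pderiv (Sum.inl 1) f := rfl

/-- **The joint harmonics** `ℋ := ker Δ₁ ∩ ker Δ₂` ([Ad07] Def 6.1 for the pair `(U(1), U(2,1))`).
[cite: Adams2007Theta, §6 Def 6.1] -/
def IsHarmonic (f : Model) : Prop := ∀ a : Fin 2, Delta a f = 0

/-- Coefficients of `Δ_a f`. [folklore] -/
theorem coeff_Delta (a : Fin 2) (f : Model) (m : Var →₀ ℕ) :
    coeff m (Delta a f) =
      coeff (m + single (Sum.inl a) 1 + single (Sum.inr ()) 1) f *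
        (((m (Sum.inr ()) : ℂ) + 1) * ((m (Sum.inl a) : ℂ) + 1)) := by
  rw [Delta_apply, coeff_pderiv, coeff_pderiv]
  have h1 : (m + single (Sum.inl a) 1 : Var →₀ ℕ) (Sum.inr ()) = m (Sum.inr ()) := by
    rw [Finsupp.add_apply, single_apply, if_neg (by simp), add_zero]
  rw [h1]
  ring

/-- `ℋ = ℂ[z₁,z₂] + w ℂ[w]`: `f` is harmonic iff no monomial of `f` involves `w` together with some `z_a`. [folklore] -/
theorem isHarmonic_iff_support (f : Model) :
    IsHarmonic f ↔ ∀ m ∈ f.support, m (Sum.inr ()) = 0 ∨ (m (Sum.inl 0) = 0 ∧ m (Sum.inl 1) = 0) := by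
  classical
  constructor
  · intro h m hm
    have key : ∀ a : Fin 2, m (Sum.inl a) ≠ 0 → m (Sum.inr ()) ≠ 0 → False := by
      intro a ha hw
      have hle : single (Sum.inl a) 1 + single (Sum.inr ()) 1 ≤ m := by
        intro v
        rw [Finsupp.add_apply, single_apply, single_apply]
        split_ifs with h₁ h₂ h₂
        · exact absurd (h₁.trans h₂.symm) Sum.inl_ne_inr
        · subst h₁; omega
        · subst h₂; omega
        · exact Nat.zero_le _
      set m' := m - (single (Sum.inl a) 1 + single (Sum.inr ()) 1) with hm'_def
      have hm' : m' + single (Sum.inl a) 1 + single (Sum.inr ()) 1 = m := by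
        rw [add_assoc, hm'_def, tsub_add_cancel_of_le hle]
      have hc : coeff m' (Delta a f) = 0 := by rw [h a, coeff_zero]
      rw [coeff_Delta, hm'] at hc
      rcases mul_eq_zero.mp hc with h1 | h2
      · exact (MvPolynomial.mem_support_iff.mp hm) h1
      · rcases mul_eq_zero.mp h2 with h3 | h3
        · exact Nat.cast_add_one_ne_zero _ h3
        · exact Nat.cast_add_one_ne_zero _ h3
    by_cases hw : m (Sum.inr ()) = 0
    · exact Or.inl hw
    · by_cases h0 : m (Sum.inl 0) = 0
      · by_cases h1 : m (Sum.inl 1) = 0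
        · exact Or.inr ⟨h0, h1⟩
        · exact (key 1 h1 hw).elim
      · exact (key 0 h0 hw).elim
  · intro h a
    ext m
    rw [coeff_Delta, coeff_zero]
    have : coeff (m + single (Sum.inl a) 1 + single (Sum.inr ()) 1) f = 0 := by
      by_contra hne
      have hm := h _ (MvPolynomial.mem_support_iff.mpr hne)
      simp only [Finsupp.add_apply, single_apply] at hm
      rcases hm with hw | ⟨h0, h1⟩
      · simp at hw
      · fin_cases a
        · simp at h0
        · simp at h1
    rw [this, zero_mul]

/-! ## §2 Joint harmonic highest-weight vectors and their classification -/

/-- **A joint `K × K′`-highest-weight vector in the harmonics**: non-zero, harmonic, weighted-homogeneous of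
`U(W)`-weight `k`, row weights `(n₁, n₂)`, `w`-degree `e`, and killed by `E₊`. [cite: Ichino2022ThetaReal, §7.5 Lemma 7.10] -/
structure IsHWVector (f : Model) (k n₁ n₂ e : ℤ) : Prop where
  /-- non-zero -/
  ne : f ≠ 0
  /-- harmonic -/
  harm : IsHarmonic f
  /-- `U(W)`-weight `k` -/
  uW : IsWeightedHomogeneous uW f k
  /-- first row weight `n₁` -/
  row0 : IsWeightedHomogeneous (rowW 0) f n₁
  /-- second row weight `n₂` -/
  row1 : IsWeightedHomogeneous (rowW 1) f n₂
  /-- `w`-degree `e` -/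
  wdeg : IsWeightedHomogeneous wDeg f e
  /-- killed by the raising operator -/
  hw : Eplus f = 0

/-- A joint weight vector with weights `(n₁, n₂, e)` is a multiple of the monomial `z₁^{n₁} z₂^{n₂} w^e`. [folklore] -/
theorem eq_smul_monomial_of_weights {f : Model} {n₁ n₂ e : ℤ}
    (h0 : IsWeightedHomogeneous (rowW 0) f n₁) (h1 : IsWeightedHomogeneous (rowW 1) f n₂)
    (he : IsWeightedHomogeneous wDeg f e) (hf : f ≠ 0) :
    0 ≤ n₁ ∧ 0 ≤ n₂ ∧ 0 ≤ e ∧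
      f = coeff (expo n₁.toNat n₂.toNat e.toNat) f • monomial (expo n₁.toNat n₂.toNat e.toNat) 1 := by
  classical
  have key : ∀ m ∈ f.support, (m (Sum.inl 0) : ℤ) = n₁ ∧ (m (Sum.inl 1) : ℤ) = n₂ ∧ (m (Sum.inr ()) : ℤ) = e := by
    intro m hm
    have hc := MvPolynomial.mem_support_iff.mp hm
    refine ⟨?_, ?_, ?_⟩
    · have := h0 hc; rwa [weight_rowW] at this
    · have := h1 hc; rwa [weight_rowW] at this
    · have := he hc; rwa [weight_wDeg] at this
  obtain ⟨m₀, hm₀⟩ : ∃ m, m ∈ f.support := by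
    by_contra hno
    apply hf
    ext m
    rw [coeff_zero]
    by_contra hne
    exact hno ⟨m, MvPolynomial.mem_support_iff.mpr hne⟩
  obtain ⟨k0, k1, k2⟩ := key m₀ hm₀
  refine ⟨by omega, by omega, by omega, ?_⟩
  have hM : ∀ m ∈ f.support, m = expo n₁.toNat n₂.toNat e.toNat := by
    intro m hm
    obtain ⟨j0, j1, j2⟩ := key m hm
    refine var_ext ?_ ?_ ?_
    · rw [expo_inl0]; omega
    · rw [expo_inl1]; omega
    · rw [expo_inr]; omega
  ext m
  rw [coeff_smul, coeff_monomial, smul_eq_mul]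
  by_cases hm : expo n₁.toNat n₂.toNat e.toNat = m
  · rw [if_pos hm, mul_one, hm]
  · rw [if_neg hm, mul_zero]
    by_contra hne
    exact hm (hM m (MvPolynomial.mem_support_iff.mpr hne)).symm

/-- `E₊` on a monomial vanishes iff `z₂` does not occur (`c ≠ 0`). [folklore] -/
theorem Eplus_monomial_eq_zero_iff (m : Var →₀ ℕ) (c : ℂ) (hc : c ≠ 0) :
    Eplus (monomial m c) = 0 ↔ m (Sum.inl 1) = 0 := by
  classical
  rw [Eplus_apply, mul_eq_zero, pderiv_monomial]
  constructor
  · rintro (h | h)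
    · exact absurd h (X_ne_zero _)
    · rw [monomial_eq_zero] at h
      rcases mul_eq_zero.mp h with h' | h'
      · exact absurd h' hc
      · exact_mod_cast h'
  · intro h
    right
    rw [h]; simp

/-- A monomial is harmonic iff it is a pure `z`-monomial or a pure power of `w`. [folklore] -/
theorem isHarmonic_monomial_iff (n₁ n₂ e : ℕ) (c : ℂ) (hc : c ≠ 0) :
    IsHarmonic (monomial (expo n₁ n₂ e) c) ↔ e = 0 ∨ (n₁ = 0 ∧ n₂ = 0) := by
  classical
  rw [isHarmonic_iff_support]
  constructor
  · intro h
    have := h (expo n₁ n₂ e) (by rw [MvPolynomial.mem_support_iff, coeff_monomial, if_pos rfl]; exact hc)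
    simpa using this
  · intro h m hm
    rw [support_monomial, if_neg hc, Finset.mem_singleton] at hm
    subst hm
    simpa using h

/-- **Classification of the joint harmonic highest-weight vectors of `ℂ[z₁,z₂,w]`**: exactly the multiples of `z₁^a`
(`a ≥ 0`; weights `k = n₁ = a`, `n₂ = e = 0`) and of `w^d` (`d ≥ 1`; `k = −d`, `n₁ = n₂ = 0`, `e = d`) — the content of
[Ich22] Lemma 7.10 for `(p,q;r,s) = (1,0;2,1)` in the vacuum-normalised explicit model.
[cite: Ichino2022ThetaReal, §7.5 Lemma 7.10] -/
theorem isHWVector_iff (f : Model) (k n₁ n₂ e : ℤ) :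
    IsHWVector f k n₁ n₂ e ↔
      (∃ (a : ℕ) (c : ℂ), c ≠ 0 ∧ f = c • (X (Sum.inl 0) : Model) ^ a ∧ k = a ∧ n₁ = a ∧ n₂ = 0 ∧ e = 0) ∨
      (∃ (d : ℕ) (c : ℂ), 1 ≤ d ∧ c ≠ 0 ∧ f = c • (X (Sum.inr ()) : Model) ^ d ∧
        k = -(d : ℤ) ∧ n₁ = 0 ∧ n₂ = 0 ∧ e = d) := by
  classical
  constructor
  · intro H
    obtain ⟨hn₁, hn₂, he, hf⟩ := eq_smul_monomial_of_weights H.row0 H.row1 H.wdeg H.ne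
    set c := coeff (expo n₁.toNat n₂.toNat e.toNat) f with hc_def
    have hc : c ≠ 0 := by
      intro h0; apply H.ne; rw [hf, h0, zero_smul]
    have hfm : f = monomial (expo n₁.toNat n₂.toNat e.toNat) c := by
      rw [hf, smul_monomial, smul_eq_mul, mul_one]
    have hn₂0 : n₂.toNat = 0 := by
      have h := H.hw
      rw [hfm, Eplus_monomial_eq_zero_iff _ _ hc] at h
      simpa using h
    have hharm : e.toNat = 0 ∨ (n₁.toNat = 0 ∧ n₂.toNat = 0) := by
      have h := H.harm
      rw [hfm, isHarmonic_monomial_iff _ _ _ _ hc] at h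
      exact h
    have hk : k = n₁ + n₂ - e := by
      have h := H.uW (d := expo n₁.toNat n₂.toNat e.toNat)
        (by rw [hfm, coeff_monomial, if_pos rfl]; exact hc)
      rw [weight_uW, expo_inl0, expo_inl1, expo_inr] at h
      omega
    rcases hharm with he0 | ⟨hn₁0, -⟩
    · left
      refine ⟨n₁.toNat, c, hc, ?_, by omega, by omega, by omega, by omega⟩
      rw [hfm, X_inl0_pow_eq, smul_monomial, smul_eq_mul, mul_one, hn₂0, he0]
    · by_cases he0 : e.toNat = 0
      · left
        refine ⟨0, c, hc, ?_, by omega, by omega, by omega, by omega⟩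
        rw [hfm, X_inl0_pow_eq, smul_monomial, smul_eq_mul, mul_one, hn₁0, hn₂0, he0]
      · right
        refine ⟨e.toNat, c, Nat.one_le_iff_ne_zero.mpr he0, hc, ?_, by omega, by omega, by omega, by omega⟩
        rw [hfm, X_inr_pow_eq, smul_monomial, smul_eq_mul, mul_one, hn₁0, hn₂0]
  · rintro (⟨a, c, hc, rfl, rfl, rfl, rfl, rfl⟩ | ⟨d, c, hd, hc, rfl, rfl, rfl, rfl, rfl⟩)
    · have hm : c • (X (Sum.inl 0) : Model) ^ a = monomial (expo a 0 0) c := by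
        rw [X_inl0_pow_eq, smul_monomial, smul_eq_mul, mul_one]
      refine ⟨?_, ?_, ?_, ?_, ?_, ?_, ?_⟩
      · rw [hm, Ne, monomial_eq_zero]; exact hc
      · rw [hm, isHarmonic_monomial_iff _ _ _ _ hc]; exact Or.inl rfl
      · rw [hm]; exact isWeightedHomogeneous_monomial _ _ _ (by rw [weight_uW]; simp)
      · rw [hm]; exact isWeightedHomogeneous_monomial _ _ _ (by rw [weight_rowW]; simp)
      · rw [hm]; exact isWeightedHomogeneous_monomial _ _ _ (by rw [weight_rowW]; simp)
      · rw [hm]; exact isWeightedHomogeneous_monomial _ _ _ (by rw [weight_wDeg]; simp)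
      · rw [hm, Eplus_monomial_eq_zero_iff _ _ hc]; simp
    · have hm : c • (X (Sum.inr ()) : Model) ^ d = monomial (expo 0 0 d) c := by
        rw [X_inr_pow_eq, smul_monomial, smul_eq_mul, mul_one]
      refine ⟨?_, ?_, ?_, ?_, ?_, ?_, ?_⟩
      · rw [hm, Ne, monomial_eq_zero]; exact hc
      · rw [hm, isHarmonic_monomial_iff _ _ _ _ hc]; exact Or.inr ⟨rfl, rfl⟩
      · rw [hm]; exact isWeightedHomogeneous_monomial _ _ _ (by rw [weight_uW]; simp)
      · rw [hm]; exact isWeightedHomogeneous_monomial _ _ _ (by rw [weight_rowW]; simp)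
      · rw [hm]; exact isWeightedHomogeneous_monomial _ _ _ (by rw [weight_rowW]; simp)
      · rw [hm]; exact isWeightedHomogeneous_monomial _ _ _ (by rw [weight_wDeg]; simp)
      · rw [hm, Eplus_monomial_eq_zero_iff _ _ hc]; simp

end ExplicitLine

end Literature.RepresentationTheory.Ichino2022
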